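import Literature.NumberTheory.NumberFields.AmbiguousClassNumberNarrowInequality
import Literature.NumberTheory.NumberFields.AmbiguousClassGenusLowerBound
import Literature.NumberTheory.NumberFields.QuadraticExtensionOddClassNumberNonNormUnit
import Literature.NumberTheory.QuadraticForms.HasseNormTheoremHolds
import Literature.NumberTheory.QuadraticForms.HilbertSymbolAtUnramifiedPlace
import Literature.NumberTheory.QuadraticForms.HilbertSymbolBilinear
import Literature.NumberTheory.QuadraticForms.HilbertSymbolArchimedean
import Literature.NumberTheory.QuadraticForms.HasseMinkowskiTernaryLemmas
import HarnessLib

/-!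
# Chevalley's formula at `p = 2` with the narrow class number of the base, the LOWER half:
# `ord₂ h⁺(K) ≤ ord₂ #Cl(L)^G + 1` and `ord₂ h⁺(K) − ord₂ h(K) ≤ rank₂ Cl(L) + 1` for every totally complex quadratic `L/K`
# (genus theory with signatures + the Hasse norm theorem; proved, no definition, no named fact)

`Proofs`-style file (theorems only, no `sorry`, no instance) in topic `NumberTheory/NumberFields` (namespace
`Literature.NumberTheory.NumberFields.AmbiguousClass`, that of `AmbiguousClassNumberFormula.lean`), written by the prover seat
`bsd-line-att-p4` g26 (cell `bsd-f1-sign2`; `--supports` stmt-BirchSwinnertonDyer-22298; closes nothing).  It is the companion of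
`AmbiguousClassNumberNarrowInequality.lean` (bsd-2adic w2 GEN 8: the UPPER bound `ord₂ #Cl(L)^G + 1 ≤ ord₂ h⁺(K) + t`): together the two files
pin the number of ambiguous classes of a totally complex quadratic extension between `h⁺(K)/2` and `h⁺(K)·2^{t−1}`.

THE POINT.  In Chevalley's ambiguous class number formula (tree `ambiguousClassNumberFormula`, Lang Ch. 13 §4 Lemma 4.1)

  `#Cl(L)^G · 2 · [E_K : E_K ∩ N_{L/K} Lˣ] = h(K) · 2^t · 2^{r₁(K)}`   (`L/K` quadratic, `L` totally complex, `t` ramified finite primes)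

the unit norm index is controlled FROM ABOVE by the HASSE NORM THEOREM: a unit of `K` which is totally positive and a local norm at the `t`
ramified finite primes is a local norm everywhere (at the unramified finite primes every unit is a local norm, O'Meara 63:16; at a real
place a positive number is a norm from `ℂ`; complex places impose nothing), hence a global norm from `L` (O'Meara 65:23 / Vignéras III
Cor. 3.4, tree `hilbertSymbol_eq_one_of_forall_completions_holds`).  The local norm conditions are `t` characters of order `≤ 2`
(the Hilbert symbols `(m, ·)_𝔭`, `L = K(√m)`, bimultiplicative at every finite place — tree `hilbertSymbol_adicCompletion_mul_right`), so

  **`[E_K : E_K ∩ N Lˣ] ∣ #sign(E_K) · 2^t`**   (§3, `relIndex_unitsNorm_dvd_card_unitSignatures_mul_two_pow`; no hypothesis on `L` at infinity),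

and with Fröhlich–Taylor's `h⁺(K) · #sign(E_K) = h(K) · 2^{r₁(K)}` (tree `narrowClassNumber_mul_card_unitSignatures`) Chevalley's formula becomes
the LOWER bound **`ord₂ h⁺(K) ≤ ord₂ #Cl(L)^G + 1`** (§4; i.e. `h⁺(K) ∣ 2 · #Cl(L)^G` on `2`-parts).  Finally the genus group
`Cl(L)/(I_σ Cl(L) · i(Cl(K)))` is killed by `[L:K] = 2` (tree `range_pow_finrank_le_sup`), which gives the divisibility
`#Cl(L)^G ∣ [Cl(L) : Cl(L)²] · h(K)` (§1–§2, the divisibility twin of the tree's `card_fixed_le_index_mul_classNumber`), whence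

  ★ **`ord₂ h⁺(K) − ord₂ h(K) ≤ rank₂ Cl(L) + 1`**   (§4, `padicValNat_two_narrowClassNumber_le_classNumber_add_rank_add_one`):

THE NARROW DEFECT OF `K` IS AT MOST ONE MORE THAN THE `2`-RANK OF THE CLASS GROUP OF ANY TOTALLY COMPLEX QUADRATIC EXTENSION.  Consumer: the
NECESSITY of a bounded narrow defect along the cyclotomic `ℤ₂`-tower of `K` given Iwasawa's `μ₂ = 0` for `K(√−1)` (the converse of the tree's
`classicalMu_sup_adjoin_of_sq_eq_neg_one_of_narrowDefect_le`), file `IwasawaTheory/NarrowDefectBoundedOfClassicalMuAdjoinI.lean`.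

* §1 (finite commutative groups) `card_fixed_dvd_index_sup_mul_card` — `#B^σ ∣ [B : B^d · I_σ] · #J` when `B^d ≤ J · I_σ`.
* §2 (number fields, `L/K` cyclic) `card_fixed_dvd_index_range_pow_mul_classNumber` — `#Cl(L)^G ∣ [Cl(L) : Cl(L)^{[L:K]}] · h(K)`;
  `ramificationIdxIn_eq_one_iff_isUnramifiedIn` (Galois `L/K`: `e_𝔭 = 1` iff Mathlib-unramified at `𝔭`);
  `exists_generator_of_finrank_eq_two` (`L = K(s)`, `s² = m ∈ K`, `σ s = −s`).
* §3 ★ `relIndex_unitsNorm_dvd_card_unitSignatures_mul_two_pow` — the Hasse-norm bound on Chevalley's unit index (any quadratic `L/K`).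
* §4 ★ `padicValNat_two_narrowClassNumber_le_card_fixed_add_one` (`L` totally complex: `ord₂ h⁺(K) ≤ ord₂ #Cl(L)^G + 1`),
  ★ `padicValNat_two_narrowClassNumber_le_classNumber_add_rank_add_one` (`ord₂ h⁺(K) ≤ ord₂ h(K) + rank₂ Cl(L) + 1`), and the two-sided
  display `padicValNat_two_card_fixed_sandwich` with GEN 8's upper bound.

Not found in print in this packaged form (it is the lower half of genus theory with signatures for `K(√m)/K`, [Gras2003] IV.4, with the unit
index evaluated by the norm theorem as in [Lang1990] Ch. 13 §4 proof of Lemma 4.2); ingredients cited at each use (D-0014: our proof of a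
statement assembled from cited ingredients).  presearch: «narrow class number at most twice the number of ambiguous classes of a totally
imaginary quadratic extension / totally positive units local norms Hasse» → corpus (hybrid + vsearch) and galaxy («ambiguous class|narrow class
number|Hasse norm») give the upper-bound/odd-`h` literature already cited by the sibling files ([Lang1990] pp. 203–206, [Gras2003] IV.4,
[Horie1994] Lemma 1, [Yu2014AmbiguousClassNumberFormulas]); no statement of the lower bound as such.  No class group is computed here.

References: [Lang1990] S. Lang, *Cyclotomic Fields I and II*, Ch. 13 §4 Lemma 4.1–4.2 (PDF pp. 203–204); [Gras2003] G. Gras, *Class Field Theory*,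
II.6.2.3, IV.4 (genus theory with signatures); [Omeara1963] O. T. O'Meara, *Introduction to Quadratic Forms*, 63:10, 63:16, 65:23;
[VignerasLNM800] Ch. III §3 Cor. 3.4; [FrohlichTaylor1990] Ch. V §1 (1.8)–(1.12), pp. 163–164; [Horie1994] §1 Lemma 1 (the shape of the unit index);
[NeukirchANT1999] Ch. III §1 Prop. (1.6) (iv).
-/

set_option autoImplicit false

noncomputable section

open NumberField NumberField.InfinitePlace IsDedekindDomain
open scoped nonZeroDivisors Classical

namespace Literature.NumberTheory.NumberFields.AmbiguousClass

open Literature.NumberTheory.GaloisRepresentations Literature.NumberTheory.GaloisRepresentations.Herbrand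
  Literature.NumberTheory.GaloisRepresentations.MinkowskiUnit
  Literature.NumberTheory.GaloisRepresentations.CyclicNormIndex
  Literature.NumberTheory.QuadraticForms

/-- `a ∣ b ≠ 0 ⟹ ord_p a ≤ ord_p b`. [folklore] -/
private theorem padicValNat_le_of_dvd' {p a b : ℕ} [Fact p.Prime] (hb : b ≠ 0) (h : a ∣ b) :
    padicValNat p a ≤ padicValNat p b :=
  (padicValNat_dvd_iff_le hb).1 (pow_padicValNat_dvd.trans h)

/-! ## §1 Finite commutative groups: `#B^σ ∣ [B : B^d · I_σ] · #J` -/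

section Group

variable {B : Type*} [CommGroup B] [Finite B]

/-- Rank–nullity for an endomorphism of a finite commutative group: `[B : f(B)] = #ker f`. [folklore] -/
private theorem index_range_eq_card_ker' (f : B →* B) : f.range.index = Nat.card f.ker := by
  have h1 := Subgroup.card_mul_index f.ker
  rw [Subgroup.index_ker] at h1
  have h2 := Subgroup.card_mul_index f.range
  rw [← h2, mul_comm] at h1
  exact (Nat.eq_of_mul_eq_mul_left Nat.card_pos h1).symm

/-- `#(B / I_σ) = #B^σ` (`I_σ = {σx·x⁻¹}` the range of `σ/id`, whose kernel is the fixed subgroup). [folklore] -/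
private theorem index_range_div_id_eq_card_fixed'' (σ : B →* B) :
    (σ / MonoidHom.id B).range.index = Nat.card {x : B // σ x = x} := by
  rw [index_range_eq_card_ker']
  refine Nat.card_congr (Equiv.subtypeEquivRight fun x => ?_)
  rw [MonoidHom.mem_ker, MonoidHom.div_apply, MonoidHom.id_apply, div_eq_one]

/-- **The lower genus bound as a DIVISIBILITY.**  `σ : B →* B` an endomorphism of a finite commutative group, `J ≤ B`, `d : ℕ` with
`B^d ≤ J · I_σ` (`I_σ = {σx·x⁻¹}`): **`#B^σ ∣ [B : B^d · I_σ] · #J`** — `#B^σ = [B : I_σ] = [J·I_σ : I_σ] · [B : J·I_σ]`, the first factor is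
`[J : J ∩ I_σ] ∣ #J`, the second divides `[B : B^d·I_σ]` since `B^d · I_σ ≤ J · I_σ`.  (Divisibility twin of the tree's
`card_fixed_le_index_sup_mul_card`.) [cite: Gras2003, IV.4 (genus exact sequence)] [cite: Washington1997, §13.3 Lemma 13.18] -/
theorem card_fixed_dvd_index_sup_mul_card (σ : B →* B) (J : Subgroup B) (d : ℕ)
    (hd : (powMonoidHom d : B →* B).range ≤ J ⊔ (σ / MonoidHom.id B).range) :
    Nat.card {x : B // σ x = x} ∣ ((powMonoidHom d : B →* B).range ⊔ (σ / MonoidHom.id B).range).index * Nat.card J := by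
  classical
  set I : Subgroup B := (σ / MonoidHom.id B).range with hI
  set P : Subgroup B := (powMonoidHom d : B →* B).range with hP
  have hle : I ≤ J ⊔ I := le_sup_right
  have hmul : I.relIndex (J ⊔ I) * (J ⊔ I).index = I.index := Subgroup.relIndex_mul_index hle
  have hrel : I.relIndex (J ⊔ I) ∣ Nat.card J := by
    rw [Subgroup.relIndex_sup_right]
    exact Subgroup.relIndex_dvd_card _ _
  have hidx : (J ⊔ I).index ∣ (P ⊔ I).index := Subgroup.index_dvd_of_le (sup_le hd le_sup_right)
  rw [← index_range_div_id_eq_card_fixed'' σ, ← hI, ← hmul, mul_comm ((P ⊔ I).index)]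
  exact mul_dvd_mul hrel hidx

end Group

/-! ## §2 Number fields: the genus divisibility, the ramification dictionary, a quadratic generator -/

variable {K L : Type} [Field K] [NumberField K] [Field L] [NumberField L] [Algebra K L]

/-- **`#Cl(L)^G ∣ [Cl(L) : Cl(L)^{[L:K]}] · h(K)`** for `L/K` cyclic with `Gal(L/K) = ⟨σ⟩`: the genus group `Cl(L)/(I_σ Cl(L) · i(Cl(K)))` is killed by
`[L:K]` (tree `range_pow_finrank_le_sup`: `c^{[L:K]} = i(N c) · ∏_τ (c/τc)`), has order `#Cl(L)^G/#i(Cl(K))`, and `#i(Cl(K)) ∣ h(K)`.  So on `p`-parts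
`ord_p #Cl(L)^G ≤ ord_p [Cl(L) : Cl(L)^{[L:K]}] + ord_p h(K)`. [cite: Gras2003, IV.4 (genus exact sequence)] [cite: NeukirchANT1999, Ch. III §1 Prop. (1.6) (iv)]
[cite: Lang1990, Ch. 13 §4, Lemma 4.1] -/
theorem card_fixed_dvd_index_range_pow_mul_classNumber [IsGalois K L] {σ : L ≃ₐ[K] L}
    (hσ : ∀ τ : L ≃ₐ[K] L, τ ∈ Subgroup.zpowers σ) :
    Nat.card {c : ClassGroup (𝓞 L) // ∀ τ : L ≃ₐ[K] L, ClassGroup.mulEquiv (intAut τ) c = c} ∣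
      (powMonoidHom (Module.finrank K L) : ClassGroup (𝓞 L) →* ClassGroup (𝓞 L)).range.index * classNumber K := by
  classical
  rw [natCard_fixed_eq_natCard_fixed_generator hσ]
  refine (card_fixed_dvd_index_sup_mul_card _ _ _ (range_pow_finrank_le_sup hσ)).trans (mul_dvd_mul ?_ ?_)
  · exact Subgroup.index_dvd_of_le le_sup_left
  · rw [classNumber, ← Nat.card_eq_fintype_card, ← Subgroup.index_ker]
    exact Subgroup.index_dvd_card _

omit [NumberField L] in
/-- For a Galois extension `L/K` of number fields and a finite prime `v` of `K`: `e(v, L/K) = 1` (`Ideal.ramificationIdxIn`) iff `L/K` is unramified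
at `v` in Mathlib's sense (`Algebra.IsUnramifiedIn`; residue fields are finite, hence perfect).  (General form of the tree's CM-field instance
`IsCMField.ramificationIdxIn_eq_one_iff_isUnramifiedIn`.) [cite: NeukirchANT1999, Ch. I §8 Prop. (8.2) and §9 Prop. (9.1)] -/
theorem ramificationIdxIn_eq_one_iff_isUnramifiedIn [NumberField L] [IsGalois K L] (v : HeightOneSpectrum (𝓞 K)) :
    v.asIdeal.ramificationIdxIn (𝓞 L) = 1 ↔ Algebra.IsUnramifiedIn (𝓞 L) v.asIdeal := by
  rw [Algebra.isUnramifiedIn_iff_forall_ramificationIdx_eq_one]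
  constructor
  · intro h1 Q _ hQover
    haveI := hQover
    rw [← Ideal.ramificationIdxIn_eq_ramificationIdx v.asIdeal Q (L ≃ₐ[K] L)]
    exact h1
  · intro h
    haveI := v.isMaximal
    obtain ⟨Q, hQmax, hQover⟩ :=
      Ideal.exists_maximal_ideal_liesOver_of_isIntegral (S := 𝓞 L) v.asIdeal
    haveI := hQmax
    haveI := hQover
    rw [Ideal.ramificationIdxIn_eq_ramificationIdx v.asIdeal Q (L ≃ₐ[K] L)]
    exact h Q hQover

/-- **A quadratic Galois extension is `K(s)` with `s² = m ∈ K`, `σ s = −s`** (`char K = 0`): with `σ ≠ 1` the non-trivial automorphism and `x` not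
fixed by `σ`, `s := x − σ x` is anti-fixed and non-zero, `s² ∈ K` (fixed by `Gal = {1, σ}`), and `s ∉ K`.
[cite: Lang1990, Ch. 13 §4 (cyclic extensions) (PDF p. 203)] [cite: Omeara1963, §63B (63:10)] -/
theorem exists_generator_of_finrank_eq_two [IsGalois K L] (h2 : Module.finrank K L = 2) :
    ∃ (σ : L ≃ₐ[K] L) (s : L) (m : K), σ ≠ 1 ∧ (∀ f : L ≃ₐ[K] L, f = 1 ∨ f = σ) ∧ (∀ τ : L ≃ₐ[K] L, τ ∈ Subgroup.zpowers σ) ∧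
      s ≠ 0 ∧ σ s = -s ∧ s ^ 2 = algebraMap K L m ∧ s ∉ Set.range (algebraMap K L) := by
  classical
  obtain ⟨σ, hσ1, hall, hgen⟩ := exists_algEquiv_ne_one_of_finrank_eq_two (K := K) (L := L) h2
  have hσσ : ∀ x, σ (σ x) = x := by
    intro x
    rcases hall (σ * σ) with h | h
    · rw [← AlgEquiv.mul_apply, h, AlgEquiv.one_apply]
    · exact absurd (mul_eq_left.mp h) hσ1
  obtain ⟨x, hx⟩ : ∃ x, σ x ≠ x := by
    by_contra h
    push Not at h
    exact hσ1 (AlgEquiv.ext h)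
  have hfix : ∀ z : L, σ z = z → z ∈ Set.range (algebraMap K L) := by
    intro z hz
    refine (IsGalois.mem_range_algebraMap_iff_fixed z).mpr fun f => ?_
    rcases hall f with rfl | rfl
    · rfl
    · exact hz
  have hs : σ (x - σ x) = -(x - σ x) := by rw [map_sub, hσσ, neg_sub]
  have hs0 : x - σ x ≠ 0 := sub_ne_zero.2 (Ne.symm hx)
  obtain ⟨m, hm⟩ := hfix ((x - σ x) ^ 2) (by rw [map_pow, hs, neg_sq])
  refine ⟨σ, x - σ x, m, hσ1, hall, hgen, hs0, hs, hm.symm, ?_⟩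
  rintro ⟨r, hr⟩
  have hfixed : σ (x - σ x) = x - σ x := by rw [← hr, AlgEquiv.commutes]
  rw [hs] at hfixed
  have h2s : (2 : L) * (x - σ x) = 0 := by linear_combination -hfixed
  exact hs0 ((mul_eq_zero.1 h2s).resolve_left two_ne_zero)

/-- The norm form of a quadratic extension: `N_{L/K}(a + b s) = a² − m b²` for `s² = m`, `σ s = −s`, `Gal(L/K) = {1, σ}`.
[cite: Omeara1963, §63B (63:10)] -/
theorem norm_add_mul_generator [IsGalois K L] {σ : L ≃ₐ[K] L} (hσ1 : σ ≠ 1) (hall : ∀ f : L ≃ₐ[K] L, f = 1 ∨ f = σ)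
    {s : L} {m : K} (hs : s ^ 2 = algebraMap K L m) (hσs : σ s = -s) (a b : K) :
    Algebra.norm K (algebraMap K L a + algebraMap K L b * s) = a ^ 2 - m * b ^ 2 := by
  classical
  haveI : FiniteDimensional K L := Module.Finite.of_restrictScalars_finite ℚ K L
  apply (algebraMap K L).injective
  rw [Algebra.norm_eq_prod_automorphisms]
  have huniv : (Finset.univ : Finset (L ≃ₐ[K] L)) = {1, σ} := by
    ext f
    simp only [Finset.mem_univ, Finset.mem_insert, Finset.mem_singleton, true_iff]
    exact hall f
  rw [huniv, Finset.prod_pair hσ1.symm, AlgEquiv.one_apply, map_add, map_mul, AlgEquiv.commutes, AlgEquiv.commutes, hσs,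
    map_sub, map_pow, map_mul, map_pow, ← hs]
  ring

/-! ## §3 The Hasse norm theorem bounds Chevalley's unit index: `[E_K : E_K ∩ N_{L/K} Lˣ] ∣ #sign(E_K) · 2^t` -/

omit [NumberField K] in
/-- A unit of `𝓞 K` lies in no finite prime. [folklore] -/
private theorem unit_notMem' (u : (𝓞 K)ˣ) (v : HeightOneSpectrum (𝓞 K)) : (u : 𝓞 K) ∉ v.asIdeal :=
  fun h => v.isPrime.ne_top (Ideal.eq_top_of_isUnit_mem _ h u.isUnit)

/-- ★ **THE HASSE-NORM BOUND ON CHEVALLEY'S UNIT INDEX.**  `L/K` Galois of degree `2`, `t` the number of finite primes of `K` ramified in `L`,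
`#sign(E_K)` the number of signatures of units of `K`.  Then

  **`[E_K : E_K ∩ N_{L/K} Lˣ] ∣ #sign(E_K) · 2^t`.**

Write `L = K(s)`, `s² = m`.  The subgroup `B ≤ E_K` of units `u` which are totally positive AND satisfy `(m, u)_𝔭 = 1` at the `t` ramified primes has
index dividing `#sign(E_K) · 2^t` (it is the kernel of `(sign, ((m, ·)_𝔭)_𝔭) : E_K → sign(E_K) × {±1}^t`, the local symbols being multiplicative at
every finite place, O'Meara 63:13a), and `B ⊆ N_{L/K} Lˣ`: for `u ∈ B` the symbol `(m, u)_v` is `1` at the ramified primes by definition, at the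
unramified primes because `u` is a `v`-unit (O'Meara 63:16), at the real places because `u` is positive there, at the complex places always; so by
HASSE'S NORM THEOREM for the quadratic extension `L/K` (O'Meara 65:23 / Vignéras III Cor. 3.4, tree `hilbertSymbol_eq_one_of_forall_completions_holds`)
`(m, u)_K = 1`, i.e. `u = a² − m b² = N_{L/K}(a + b s)`.  No hypothesis at the infinite places. [cite: Omeara1963, §63C Example 63:16 and §65D Thm. 65:23]
[cite: VignerasLNM800, Ch. III §3 Cor. 3.4] [cite: Lang1990, Ch. 13 §4, proof of Lemma 4.2 (the norm index of units) (PDF p. 204)]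
[cite: Gras2003, II.6.2.3 and IV.4] -/
theorem relIndex_unitsNorm_dvd_card_unitSignatures_mul_two_pow [IsGalois K L] (h2 : Module.finrank K L = 2) :
    (unitsE L ⊓ (⊤ : Subgroup Lˣ).map (Herbrand.norm (L ≃ₐ[K] L))).relIndex (unitsE L ⊓ (unitsIncl K L).range) ∣
      Nat.card ((unitsRange K).map (Literature.NumberTheory.NumberFields.signHom K)) *
        2 ^ {v : HeightOneSpectrum (𝓞 K) | v.asIdeal.ramificationIdxIn (𝓞 L) ≠ 1}.ncard := by
  classical
  obtain ⟨σ, hσ1, hall, hσ, s, m, hs0, hσs, hs, hsK⟩ :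
      ∃ (σ : L ≃ₐ[K] L), σ ≠ 1 ∧ (∀ f : L ≃ₐ[K] L, f = 1 ∨ f = σ) ∧ (∀ τ : L ≃ₐ[K] L, τ ∈ Subgroup.zpowers σ) ∧
        ∃ (s : L) (m : K), s ≠ 0 ∧ σ s = -s ∧ s ^ 2 = algebraMap K L m ∧ s ∉ Set.range (algebraMap K L) := by
    obtain ⟨σ, s, m, hσ1, hall, hσ, hs0, hσs, hs, hsK⟩ := exists_generator_of_finrank_eq_two (K := K) (L := L) h2
    exact ⟨σ, hσ1, hall, hσ, s, m, hs0, hσs, hs, hsK⟩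
  have hαK : ∀ r : K, algebraMap K L r ≠ s := fun r hr => hsK ⟨r, hr⟩
  haveI : Algebra.IsQuadraticExtension K L := ⟨h2⟩
  have hm0 : m ≠ 0 := by
    intro h0
    rw [h0, map_zero, sq_eq_zero_iff] at hs
    exact hs0 hs
  have hmsq : ¬ IsSquare m := by
    rintro ⟨r, hr⟩
    have hsq : s ^ 2 = (algebraMap K L r) ^ 2 := by rw [hs, hr, map_mul, sq]
    rcases sq_eq_sq_iff_eq_or_eq_neg.1 hsq with h | h
    · exact hαK r h.symm
    · exact hαK (-r) (by rw [map_neg, h])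
  -- the unit index as an index in `𝓞_Kˣ`
  set Φ : (𝓞 K)ˣ →* Lˣ := (unitsIncl K L).comp (Units.map (algebraMap (𝓞 K) K : 𝓞 K →* K)) with hΦ
  set A : Subgroup Lˣ := unitsE L ⊓ (⊤ : Subgroup Lˣ).map (Herbrand.norm (L ≃ₐ[K] L)) with hA
  have hidx : A.relIndex (unitsE L ⊓ (unitsIncl K L).range) = (A.comap Φ).index := by
    rw [← range_unitsIncl_comp_unitsMap_eq, hΦ, Subgroup.index_comap]
  -- the signature homomorphism on `𝓞_Kˣ`
  set Sg : (𝓞 K)ˣ →* Multiplicative ((K →+* ℝ) → ZMod 2) :=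
    (Literature.NumberTheory.NumberFields.signHom K).comp (Units.map (algebraMap (𝓞 K) K : 𝓞 K →* K)) with hSg
  have hker : Sg.ker.index = Nat.card ((unitsRange K).map (Literature.NumberTheory.NumberFields.signHom K)) := by
    rw [Subgroup.index_ker, ← range_signHom_comp_unitsMap (K := K)]
  -- the ramified primes and the local symbols there
  set R : Set (HeightOneSpectrum (𝓞 K)) := {v : HeightOneSpectrum (𝓞 K) | v.asIdeal.ramificationIdxIn (𝓞 L) ≠ 1} with hR
  have hRfin : R.Finite := AmbiguousIdeal.finite_setOf_ramificationIdxIn_ne_one (K := K) (L := L)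
  haveI : Finite R := hRfin.to_subtype
  have hu0 : ∀ (v : HeightOneSpectrum (𝓞 K)) (u : (𝓞 K)ˣ),
      algebraMap K (v.adicCompletion K) (((u : 𝓞 K) : K)) ≠ 0 := fun v u =>
    (map_ne_zero _).2 (by exact_mod_cast u.ne_zero)
  have hmv : ∀ v : HeightOneSpectrum (𝓞 K), algebraMap K (v.adicCompletion K) m ≠ 0 := fun v => (map_ne_zero _).2 hm0
  let sy : HeightOneSpectrum (𝓞 K) → ((𝓞 K)ˣ →* ℤ) := fun v =>
    { toFun := fun u => hilbertSymbol (v.adicCompletion K) (algebraMap K _ m) (algebraMap K _ ((u : 𝓞 K) : K))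
      map_one' := by
        simp only [Units.val_one, map_one]
        rw [hilbertSymbol_comm]
        exact hilbertSymbol_eq_one_of_isSquare ⟨1, (mul_one 1).symm⟩ one_ne_zero _
      map_mul' := fun x y => by
        simp only [Units.val_mul, map_mul]
        exact hilbertSymbol_adicCompletion_mul_right K v (hu0 v x) (hu0 v y) (hmv v) }
  have sy_apply : ∀ (v : HeightOneSpectrum (𝓞 K)) (u : (𝓞 K)ˣ),
      sy v u = hilbertSymbol (v.adicCompletion K) (algebraMap K _ m) (algebraMap K _ ((u : 𝓞 K) : K)) := fun _ _ => rfl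
  let Sy : (𝓞 K)ˣ →* (R → ℤˣ) := MonoidHom.pi fun v : R => (sy v.1).toHomUnits
  have Sy_apply : ∀ (u : (𝓞 K)ˣ) (v : R), ((Sy u v : ℤˣ) : ℤ) = sy v.1 u := fun _ _ => rfl
  -- (a) `ker Sg ⊓ ker Sy ⊆ Φ⁻¹(E ∩ N Lˣ)`: the Hasse norm theorem
  have hB : Sg.ker ⊓ Sy.ker ≤ A.comap Φ := by
    intro u hu
    obtain ⟨hug, huy⟩ := Subgroup.mem_inf.1 hu
    rw [Subgroup.mem_comap, hA]
    refine Subgroup.mem_inf.2 ⟨?_, ?_⟩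
    · have hmem : Φ u ∈ Φ.range := ⟨u, rfl⟩
      rw [hΦ, range_unitsIncl_comp_unitsMap_eq] at hmem
      exact (Subgroup.mem_inf.1 hmem).1
    · -- positivity at the real embeddings
      have hpos : ∀ ρ : K →+* ℝ, 0 < ρ ((u : 𝓞 K) : K) := by
        have h1 : Units.map (algebraMap (𝓞 K) K : 𝓞 K →* K) u ∈ (Literature.NumberTheory.NumberFields.signHom K).ker := by
          rw [MonoidHom.mem_ker]
          rw [MonoidHom.mem_ker, hSg, MonoidHom.comp_apply] at hug
          exact hug
        intro ρ
        have h2 := (Literature.NumberTheory.NumberFields.mem_ker_signHom_iff (K := K)).1 h1 ρ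
        simpa only [val_unitsMap] using h2
      have hune : ((u : 𝓞 K) : K) ≠ 0 := by exact_mod_cast u.ne_zero
      -- local symbols at the finite places
      have hfinite : ∀ v : HeightOneSpectrum (𝓞 K),
          hilbertSymbol (v.adicCompletion K) (algebraMap K _ m) (algebraMap K _ ((u : 𝓞 K) : K)) = 1 := by
        intro v
        by_cases hv : v.asIdeal.ramificationIdxIn (𝓞 L) ≠ 1
        · have h1 : Sy u = 1 := huy
          have h2 : ((Sy u ⟨v, hv⟩ : ℤˣ) : ℤ) = 1 := by rw [h1]; rfl
          rwa [Sy_apply, sy_apply] at h2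
        · push Not at hv
          have hunr := (ramificationIdxIn_eq_one_iff_isUnramifiedIn (K := K) (L := L) v).1 hv
          rw [hilbertSymbol_comm]
          exact hilbertSymbol_eq_one_of_notMem_of_isUnramifiedIn (K := K) (v := v) hs hαK hunr (unit_notMem' u v)
      -- local symbols at the infinite places
      have hinf : ∀ w : InfinitePlace K,
          hilbertSymbol w.Completion (algebraMap K _ m) (algebraMap K _ ((u : 𝓞 K) : K)) = 1 := by
        intro w
        rcases w.isReal_or_isComplex with hw | hw
        · exact (hilbertSymbol_completion_eq_one_iff_of_isReal hw _ _).2 (Or.inr (hpos _))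
        · exact hilbertSymbol_completion_eq_one_of_isComplex hw (Or.inl hm0)
      -- Hasse's norm theorem
      have hglob : hilbertSymbol K m ((u : 𝓞 K) : K) = 1 :=
        Literature.NumberTheory.Automorphic.hilbertSymbol_eq_one_of_forall_completions_holds K m _ hmsq hune hfinite hinf
      haveI : NeZero (2 : K) := ⟨two_ne_zero⟩
      obtain ⟨a, b, hab⟩ := (hilbertSymbol_eq_one_iff_exists_norm hm0 hune).1 hglob
      -- `y = a + b s` has norm `u`
      have hnorm : Algebra.norm K (algebraMap K L a + algebraMap K L b * s) = ((u : 𝓞 K) : K) := by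
        rw [norm_add_mul_generator hσ1 hall hs hσs, hab]
      have hy0 : algebraMap K L a + algebraMap K L b * s ≠ 0 := by
        haveI : FiniteDimensional K L := Module.Finite.of_restrictScalars_finite ℚ K L
        intro h0
        rw [h0, Algebra.norm_zero] at hnorm
        exact hune hnorm.symm
      refine ⟨Units.mk0 _ hy0, Subgroup.mem_top _, ?_⟩
      ext
      rw [coe_herbrandNorm_eq_algebraMap_norm hσ, Units.val_mk0, hnorm, hΦ, MonoidHom.comp_apply, coe_unitsIncl, val_unitsMap]
  -- (b) the indices
  have h1 : (A.comap Φ).index ∣ (Sg.ker ⊓ Sy.ker).index := Subgroup.index_dvd_of_le hB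
  have h2' : (Sg.ker ⊓ Sy.ker).index = Sy.ker.relIndex Sg.ker * Sg.ker.index := by
    rw [← Subgroup.relIndex_mul_index (inf_le_left : Sg.ker ⊓ Sy.ker ≤ Sg.ker), Subgroup.inf_relIndex_left]
  have h3 : Sy.ker.relIndex Sg.ker ∣ 2 ^ R.ncard := by
    have hrel : Sy.ker.relIndex Sg.ker = (Sy.comp Sg.ker.subtype).ker.index := by
      rw [Subgroup.relIndex, Subgroup.subgroupOf, MonoidHom.comap_ker]
    rw [hrel, Subgroup.index_ker]
    refine (Subgroup.card_subgroup_dvd_card _).trans ?_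
    rw [Nat.card_fun, Nat.card_eq_fintype_card (α := ℤˣ), Fintype.card_units_int, Nat.card_coe_set_eq]
  rw [hidx]
  refine h1.trans ?_
  rw [h2', hker, mul_comm]
  exact mul_dvd_mul_left _ h3

/-! ## §4 The lower bounds: `ord₂ h⁺(K) ≤ ord₂ #Cl(L)^G + 1 ≤ ord₂ h(K) + rank₂ Cl(L) + 1` -/

/-- ★ **CHEVALLEY AT `2` WITH THE NARROW CLASS NUMBER, LOWER HALF.**  `L/K` Galois of degree `2`, `L` totally complex:

  **`ord₂ h⁺(K) ≤ ord₂ #Cl(L)^G + 1`**   (`h⁺(K) ∣ 2 · #Cl(L)^G` on `2`-parts).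

From the valuation identity `ord₂ #Cl(L)^G + 1 + ord₂ [E_K : E_K ∩ N Lˣ] = ord₂ h(K) + t + r₁(K)` (tree `padicValNat_card_fixed_add_eq`, archimedean
factor `2^{r₁(K)}`), the Hasse-norm bound `ord₂ [E_K : E_K ∩ N Lˣ] ≤ ord₂ #sign(E_K) + t` (§3) and Fröhlich–Taylor `ord₂ h⁺ + ord₂ #sign = ord₂ h + r₁`.
Companion of GEN 8's upper bound `padicValNat_two_card_fixed_add_one_le_narrowClassNumber` (`ord₂ #Cl(L)^G + 1 ≤ ord₂ h⁺(K) + t`).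
[cite: Lang1990, Ch. 13 §4, Lemma 4.1 (PDF p. 203)] [cite: Gras2003, IV.4 (genus theory with signatures)] [cite: FrohlichTaylor1990, Ch. V §1 (1.12), p. 164]
[cite: Omeara1963, §65D Thm. 65:23] -/
theorem padicValNat_two_narrowClassNumber_le_card_fixed_add_one [IsGalois K L] [IsTotallyComplex L]
    (h2 : Module.finrank K L = 2) {σ : L ≃ₐ[K] L} (hσ : ∀ τ : L ≃ₐ[K] L, τ ∈ Subgroup.zpowers σ) :
    padicValNat 2 (narrowClassNumber K) ≤
      padicValNat 2 (Nat.card {c : ClassGroup (𝓞 L) // ∀ τ : L ≃ₐ[K] L, ClassGroup.mulEquiv (intAut τ) c = c}) + 1 := by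
  haveI : Fact (Nat.Prime 2) := ⟨Nat.prime_two⟩
  have hid := padicValNat_card_fixed_add_eq (K := K) (L := L) Nat.prime_two h2 hσ
  rw [archFactor_eq_two_pow_nrRealPlaces_of_isTotallyComplex, padicValNat.prime_pow] at hid
  have hFT := padicValNat_narrowClassNumber_add_card_unitSignatures (K := K) 2
  rw [padicValNat.prime_pow] at hFT
  have hdvd := relIndex_unitsNorm_dvd_card_unitSignatures_mul_two_pow (K := K) (L := L) h2
  have hne : Nat.card ((unitsRange K).map (Literature.NumberTheory.NumberFields.signHom K)) *
      2 ^ {v : HeightOneSpectrum (𝓞 K) | v.asIdeal.ramificationIdxIn (𝓞 L) ≠ 1}.ncard ≠ 0 :=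
    mul_ne_zero (card_unitSignatures_ne_zero (K := K)) (pow_ne_zero _ two_ne_zero)
  have hle := padicValNat_le_of_dvd' (p := 2) hne hdvd
  rw [padicValNat.mul (card_unitSignatures_ne_zero (K := K)) (pow_ne_zero _ two_ne_zero), padicValNat.prime_pow] at hle
  omega

/-- ★ **THE NARROW DEFECT IS BOUNDED BY THE `2`-RANK OF ANY TOTALLY COMPLEX QUADRATIC EXTENSION.**  `L/K` Galois of degree `2`, `L` totally complex:

  **`ord₂ h⁺(K) ≤ ord₂ h(K) + rank₂ Cl(L) + 1`**, `rank₂ Cl(L) = log₂ [Cl(L) : Cl(L)²]`,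

i.e. `ord₂ (h⁺(K)/h(K)) ≤ rank₂ Cl(L) + 1` (`h ∣ h⁺`): the previous theorem and `ord₂ #Cl(L)^G ≤ rank₂ Cl(L) + ord₂ h(K)` (§2, the genus group is killed
by `2`).  For `L = K(√−1)` along the cyclotomic `ℤ₂`-tower of `K` this turns Iwasawa's `μ₂ = 0` for `K(√−1)` (bounded `2`-ranks) into a BOUNDED NARROW
DEFECT for `K` — the necessity of hypothesis (b) of the cell's Kida-lite doors. [cite: Gras2003, IV.4 (genus theory with signatures)]
[cite: Lang1990, Ch. 13 §4, Lemma 4.1–4.2 (PDF pp. 203–204)] [cite: FrohlichTaylor1990, Ch. V §1 (1.8)–(1.12), pp. 163–164] [cite: Omeara1963, §65D Thm. 65:23] -/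
theorem padicValNat_two_narrowClassNumber_le_classNumber_add_rank_add_one [IsGalois K L] [IsTotallyComplex L]
    (h2 : Module.finrank K L = 2) :
    padicValNat 2 (narrowClassNumber K) ≤
      padicValNat 2 (classNumber K) +
        padicValNat 2 ((powMonoidHom 2 : ClassGroup (𝓞 L) →* ClassGroup (𝓞 L)).range.index) + 1 := by
  classical
  haveI : Fact (Nat.Prime 2) := ⟨Nat.prime_two⟩
  obtain ⟨σ, -, -, hσ⟩ := exists_algEquiv_ne_one_of_finrank_eq_two (K := K) (L := L) h2
  have h1 := padicValNat_two_narrowClassNumber_le_card_fixed_add_one (K := K) (L := L) h2 hσ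
  have hdvd := card_fixed_dvd_index_range_pow_mul_classNumber (K := K) (L := L) hσ
  rw [h2] at hdvd
  have hidx0 : (powMonoidHom 2 : ClassGroup (𝓞 L) →* ClassGroup (𝓞 L)).range.index ≠ 0 := Subgroup.index_ne_zero_of_finite
  have hne : (powMonoidHom 2 : ClassGroup (𝓞 L) →* ClassGroup (𝓞 L)).range.index * classNumber K ≠ 0 :=
    mul_ne_zero hidx0 (classNumber_pos K).ne'
  have hle := padicValNat_le_of_dvd' (p := 2) hne hdvd
  rw [padicValNat.mul hidx0 (classNumber_pos K).ne'] at hle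
  omega

/-- The same with `#Cl(K)` written `Nat.card (ClassGroup (𝓞 K))` and the narrow DEFECT displayed as a subtraction (`h ∣ h⁺`, so it is exact):
**`ord₂ h⁺(K) − ord₂ h(K) ≤ rank₂ Cl(L) + 1`**. [cite: Gras2003, IV.4] [cite: FrohlichTaylor1990, Ch. V §1 (1.8), (1.12), pp. 163–164] -/
theorem padicValNat_two_narrowClassNumber_sub_le_rank_add_one [IsGalois K L] [IsTotallyComplex L] (h2 : Module.finrank K L = 2) :
    padicValNat 2 (narrowClassNumber K) - padicValNat 2 (classNumber K) ≤
      padicValNat 2 ((powMonoidHom 2 : ClassGroup (𝓞 L) →* ClassGroup (𝓞 L)).range.index) + 1 := by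
  have h := padicValNat_two_narrowClassNumber_le_classNumber_add_rank_add_one (K := K) (L := L) h2
  omega

/-- **The two-sided display** (with GEN 8's upper bound): for `L/K` Galois of degree `2`, `L` totally complex, `t` ramified finite primes,
`ord₂ h⁺(K) − 1 ≤ ord₂ #Cl(L)^G ≤ ord₂ h⁺(K) + t − 1` — the number of ambiguous classes is pinned by the NARROW class number of the base up to the
`t` local norm conditions. [cite: Lang1990, Ch. 13 §4, Lemma 4.1 (PDF p. 203)] [cite: Gras2003, IV.4] -/
theorem padicValNat_two_card_fixed_sandwich [IsGalois K L] [IsTotallyComplex L]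
    (h2 : Module.finrank K L = 2) {σ : L ≃ₐ[K] L} (hσ : ∀ τ : L ≃ₐ[K] L, τ ∈ Subgroup.zpowers σ) :
    padicValNat 2 (narrowClassNumber K) ≤
        padicValNat 2 (Nat.card {c : ClassGroup (𝓞 L) // ∀ τ : L ≃ₐ[K] L, ClassGroup.mulEquiv (intAut τ) c = c}) + 1 ∧
      padicValNat 2 (Nat.card {c : ClassGroup (𝓞 L) // ∀ τ : L ≃ₐ[K] L, ClassGroup.mulEquiv (intAut τ) c = c}) + 1 ≤
        padicValNat 2 (narrowClassNumber K) + {v : HeightOneSpectrum (𝓞 K) | v.asIdeal.ramificationIdxIn (𝓞 L) ≠ 1}.ncard :=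
  ⟨padicValNat_two_narrowClassNumber_le_card_fixed_add_one h2 hσ, padicValNat_two_card_fixed_add_one_le_narrowClassNumber h2 hσ⟩

end Literature.NumberTheory.NumberFields.AmbiguousClass

end
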